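import Summits.CriticalPhenomena.PercolationContinuityZ3.Theorems.PercNearOneGluingNoHeavyLowerTailSahiGridPatternLiteralTwoAbsorbCore

/-!
# `NoHeavyLowerTail` (crux stmt-CriticalPhenomena-4575), Sahi programme P1: **THE THRESHOLD-TWO LITERAL PRESERVES GOODNESS** —
# `sStarD({ξ=2} ∪ cyl V; B, C) ≥ sStarD(V; B₀, C₁) + sStarD(V; B₁, C₀)` for EVERY up-set `V`, with no certificate

Support file (Sahi cell, seat `prim-sahi-p1`, generation 25; `--supports stmt-CriticalPhenomena-4575`).  Pure proofs, no definitions,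
no `sorry`, standard axioms.  Vocabulary of `…SahiGridPattern{CellForm,LiteralTwoAbsorb,LiteralTwoAbsorbCore}` (`glue`, `sect`, `ind`,
`sStarD`, `thetaVal`, `lamU`, `nuCount`).

THE MATHEMATICS.  Let `X = {ξ = 2} × [3]^k` (the threshold-two literal on the first axis) and `Y = [3] × V` for an ARBITRARY up-set
`V ⊆ [3]^k`, and let `B, C ⊆ [3]^{1+k}` be up-sets with sections `B_i = sect B i` (`B₀ ⊆ B₁ ⊆ B₂`).  THEOREM (`sStarD_literalTwo_ge_sections`):
  `sStarD (X ∪ Y) B C ≥ sStarD V B₀ C₁ + sStarD V B₁ C₀`.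
Consequently (`sStarD_literalTwo_nonneg_of_good`): if `V` is a good first slot of the pattern functional in its own dimension
(`sStarD V P R ≥ 0` for all up-sets `P, R`), then so is `{ξ=2} ∪ cyl V` in dimension `1+k` — the threshold-two analogue of
`literalUnion_hS`/`sStarD_cylSet_literalUnion_nonneg` (threshold one, any `V`), and the GOODNESS version of literal absorption
(`…LiteralTwoAbsorbCore` needs a diagonal certificate of `V` and yields one).  Applied to `V × [3]^m` it shows that goodness in every
dimension is preserved by the threshold-two literal (re-indexing as in `…StarCertPrelim`; not restated here).
PROOF.  Writing everything as a pair sum over totally distinct `(z, z')` of `[3]^k` (third point `z''`), the difference of the two sides is,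
after 6-fold symmetrisation, a polynomial identity (`ring`) with the five nonnegative families of `litAbsorb_core` — coefficientwise Harris
×4 (`pairKernel_harris_nonneg` at `(B₂, C_i ∩ V)`, `(C₂, B_i ∩ V)`), fibre Kleitman `2·K(V̄; B₂, C₂)` (`pairKernel_kleitman_nonneg`) — plus
ten pointwise-nonnegative products of monotone differences; the identity (154-term certificate) was found by linear programming over the
6-fold-symmetrised kernel space and is machine-checked here by `ring` (seat memo FROM-prim-sahi-p1-gen25, certs/gen25/cert_T1_clean.json).
This is the `n = 1`, `a = 2` instance of the seat's CONJECTURE Λ (goodness-free recursion for orthant absorption).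
Nothing here asserts `PatternPos d` for `d ≥ 4`. [this work]
-/

namespace Summit.CriticalPhenomena.PercolationContinuityZ3.Theorems.SahiGridPattern

open Finset SahiGrid3
open scoped BigOperators

variable {k : ℕ}

/-- **The pattern functional as a pair-sum kernel**: `sStarD V P R = Σ_{q,r}[q δ̸ r]·(1_P(q)1_R(q)(2·1_V(q) − 1_V(r)) − 1_P(q)1_R(r)·Θ)`
(the `λ`-part spread over the `2^k` partners of `q`). [this work] -/
theorem sStarD_eq_pairSum_kernel (V P R : Finset (Pd k)) :
    sStarD V P R = ∑ q : Pd k, ∑ r : Pd k, (if TotDist q r = true then (1:ℤ) else 0) *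
      (ind P q * ind R q * (2 * ind V q - ind V r) - ind P q * ind R r * (ind V q + ind V r - ind V (thirdPt q r))) := by
  rw [sStarD_eq_sum_lamU_sub_sum_thetaVal, sum_mem_eq_sum_ind_mul]
  have h1 : (∑ q : Pd k, ind (P ∩ R) q * lamU V q)
      = ∑ q : Pd k, ∑ r : Pd k, (if TotDist q r = true then (1:ℤ) else 0) * (ind P q * ind R q * (2 * ind V q - ind V r)) := by
    refine Finset.sum_congr rfl fun q _ => ?_
    rw [ind_inter_eq_mul]
    unfold lamU
    rw [nuCount_eq_sum_ind]
    have e2 : (2:ℤ) * 2 ^ k * ind V q = ∑ r : Pd k, (if TotDist q r = true then (1:ℤ) else 0) * (2 * ind V q) := by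
      rw [← Finset.sum_mul, sum_ite_totDist_eq_two_pow]; ring
    have e3 : (∑ p : Pd k, ind V p * (if TotDist p q = true then (1:ℤ) else 0))
        = ∑ r : Pd k, (if TotDist q r = true then (1:ℤ) else 0) * ind V r := by
      refine Finset.sum_congr rfl fun r _ => ?_
      rw [totDist_symm r q]; ring
    rw [e2, e3, ← Finset.sum_sub_distrib, Finset.mul_sum]
    refine Finset.sum_congr rfl fun r _ => ?_
    ring
  have h2 : (∑ q ∈ P, ∑ r ∈ R, thetaVal V q r)
      = ∑ q : Pd k, ∑ r : Pd k, (if TotDist q r = true then (1:ℤ) else 0) * (ind P q * ind R r * (ind V q + ind V r - ind V (thirdPt q r))) := by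
    rw [sum_mem_eq_sum_ind_mul]
    refine Finset.sum_congr rfl fun q _ => ?_
    rw [sum_mem_eq_sum_ind_mul, Finset.mul_sum]
    refine Finset.sum_congr rfl fun r _ => ?_
    rw [thetaVal_eq_ite_mul]; ring
  rw [h1, h2, ← Finset.sum_sub_distrib]
  refine Finset.sum_congr rfl fun q _ => ?_
  rw [← Finset.sum_sub_distrib]
  refine Finset.sum_congr rfl fun r _ => ?_
  ring

set_option maxHeartbeats 4000000 in
/-- **THE THRESHOLD-TWO LITERAL OVER ANY UP-SET: `sStarD (X ∪ Y) B C ≥ sStarD V B₀ C₁ + sStarD V B₁ C₀`** (every `k`, every up-set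
`V ⊆ [3]^k`, all up-sets `B, C ⊆ [3]^{1+k}`; `X = {ξ=2} × [3]^k`, `Y = [3] × V`, `B_i = sect B i`).  Proof: pair-sum kernel identity after
6-fold symmetrisation (`ring`) + four coefficientwise-Harris families + one fibre-Kleitman family + ten pointwise-nonnegative products. [this work] -/
theorem sStarD_literalTwo_ge_sections (ℓ : Pd 1) (hℓ : ℓ 0 = 2) {V : Finset (Pd k)} (hV : IsUpperSet (V : Set (Pd k)))
    {X Y : Finset (Pd (1 + k))}
    (hX : ∀ ξ z, glue ξ z ∈ X ↔ ξ ∈ (univ.filter fun y : Pd 1 => ∀ j, ℓ j ≤ y j)) (hY : ∀ ξ z, glue ξ z ∈ Y ↔ z ∈ V)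
    (B C : Finset (Pd (1 + k))) (hB : IsUpperSet (B : Set (Pd (1 + k)))) (hC : IsUpperSet (C : Set (Pd (1 + k)))) :
    sStarD V (sect B (fun _ => 0)) (sect C (fun _ => 1)) + sStarD V (sect B (fun _ => 1)) (sect C (fun _ => 0))
      ≤ sStarD (X ∪ Y) B C := by
  obtain ⟨i0, i1, i2⟩ := ind_literalTwo_vals ℓ hℓ
  obtain ⟨n0, n1, n2⟩ := nuCount_literalTwo_vals ℓ hℓ
  obtain ⟨-, -, -, -, -, -, -, -, -, t01, t02, t10, t12, t20, t21⟩ := pd1_facts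
  -- the two polarised pattern functionals and the union, as pair sums
  have eS01 := sStarD_eq_pairSum_kernel V (sect B (fun _ => 0)) (sect C (fun _ => 1))
  have eS10 := sStarD_eq_pairSum_kernel V (sect B (fun _ => 1)) (sect C (fun _ => 0))
  simp only [ind_sect] at eS01 eS10
  have eU := eq_add_of_sub_eq (sStarD_union_sub_pairCertSlack_eq_pairSum hX hY B C)
  rw [eU, eS01, eS10]
  set L : Finset (Pd 1) := (univ.filter fun y : Pd 1 => ∀ j, ℓ j ≤ y j) with hL
  have e4 := pairSum3_pd1_explicit (m := k) (fun (ξ η : Pd 1) (z z' : Pd k) =>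
      ( 2 * (ind L ξ + ind V z - ind L ξ * ind V z) * ind B (glue ξ z) * ind C (glue ξ z)
        - (ind L ξ + ind V z - ind L ξ * ind V z) * ind B (glue η z') * ind C (glue η z')
        - ind B (glue ξ z) * (ind L η + ind V z' - ind L η * ind V z') * ind C (glue η z')
        - ind C (glue ξ z) * (ind L η + ind V z' - ind L η * ind V z') * ind B (glue η z')
        + ind B (glue ξ z) * ind C (glue η z')
            * (ind L (thirdPt ξ η) + ind V (thirdPt z z') - ind L (thirdPt ξ η) * ind V (thirdPt z z'))
        - ind B (glue ξ z) * ind C (glue ξ z)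
            * ((1 - ind V z) * (ind L ξ - ind L η) + (1 - ind L ξ) * (1 - ind L η) * (ind V z - ind V z')) ))
  rw [e4]
  simp only [t01, t02, t10, t12, t20, t21, i0, i1, i2]
  -- the pair-certificate slack, explicitly
  have eA : (∑ z : Pd k, (1 - ind V z) * ∑ ξ : Pd 1, ind (fibre (B ∩ C) z) ξ * (2 ^ 1 * ind L ξ - (nuCount L ξ : ℤ)))
      = ∑ z : Pd k, (1 - ind V z) * (2 * (ind B (glue (fun _ => 2) z) * ind C (glue (fun _ => 2) z))
          - ind B (glue (fun _ => 0) z) * ind C (glue (fun _ => 0) z) - ind B (glue (fun _ => 1) z) * ind C (glue (fun _ => 1) z)) := by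
    refine Finset.sum_congr rfl fun z _ => ?_
    rw [sum_pd1, ind_fibre, ind_fibre, ind_fibre, ind_inter_eq_mul, ind_inter_eq_mul, ind_inter_eq_mul, i0, i1, i2, n0, n1, n2]
    push_cast
    ring
  have eB : (∑ ξ : Pd 1, (1 - ind L ξ) * (2 ^ 1 - (nuCount L ξ : ℤ)) *
            ∑ z : Pd k, ind (sect (B ∩ C) ξ) z * (2 ^ k * ind V z - (nuCount V z : ℤ)))
      = (∑ z : Pd k, ind B (glue (fun _ => 0) z) * ind C (glue (fun _ => 0) z) * (2 ^ k * ind V z - (nuCount V z : ℤ)))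
        + ∑ z : Pd k, ind B (glue (fun _ => 1) z) * ind C (glue (fun _ => 1) z) * (2 ^ k * ind V z - (nuCount V z : ℤ)) := by
    rw [sum_pd1, i0, i1, i2, n0, n1, n2]
    simp only [ind_sect, ind_inter_eq_mul]
    push_cast
    ring
  rw [eA, eB]
  -- single sums as pair sums
  have eC : (2 : ℤ) ^ k * (∑ z : Pd k, (1 - ind V z) * (2 * (ind B (glue (fun _ => 2) z) * ind C (glue (fun _ => 2) z))
          - ind B (glue (fun _ => 0) z) * ind C (glue (fun _ => 0) z) - ind B (glue (fun _ => 1) z) * ind C (glue (fun _ => 1) z)))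
        + ((∑ z : Pd k, ind B (glue (fun _ => 0) z) * ind C (glue (fun _ => 0) z) * (2 ^ k * ind V z - (nuCount V z : ℤ)))
          + ∑ z : Pd k, ind B (glue (fun _ => 1) z) * ind C (glue (fun _ => 1) z) * (2 ^ k * ind V z - (nuCount V z : ℤ)))
      = ∑ z : Pd k, ∑ z' : Pd k, (if TotDist z z' = true then (1:ℤ) else 0) *
          ((1 - ind V z) * (2 * (ind B (glue (fun _ => 2) z) * ind C (glue (fun _ => 2) z)) - ind B (glue (fun _ => 0) z) * ind C (glue (fun _ => 0) z)
              - ind B (glue (fun _ => 1) z) * ind C (glue (fun _ => 1) z))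
            + (ind B (glue (fun _ => 0) z) * ind C (glue (fun _ => 0) z) + ind B (glue (fun _ => 1) z) * ind C (glue (fun _ => 1) z)) * (ind V z - ind V z')) := by
    rw [Finset.mul_sum, ← Finset.sum_add_distrib, ← Finset.sum_add_distrib]
    refine Finset.sum_congr rfl fun z _ => ?_
    rw [nuCount_eq_sum_ind]
    have e3 : (∑ p : Pd k, ind V p * (if TotDist p z = true then (1:ℤ) else 0))
        = ∑ z' : Pd k, (if TotDist z z' = true then (1:ℤ) else 0) * ind V z' := by
      refine Finset.sum_congr rfl fun r _ => ?_
      rw [totDist_symm r z]; ring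
    have split : ∀ z' : Pd k, (if TotDist z z' = true then (1:ℤ) else 0) *
          ((1 - ind V z) * (2 * (ind B (glue (fun _ => 2) z) * ind C (glue (fun _ => 2) z)) - ind B (glue (fun _ => 0) z) * ind C (glue (fun _ => 0) z)
              - ind B (glue (fun _ => 1) z) * ind C (glue (fun _ => 1) z))
            + (ind B (glue (fun _ => 0) z) * ind C (glue (fun _ => 0) z) + ind B (glue (fun _ => 1) z) * ind C (glue (fun _ => 1) z)) * (ind V z - ind V z'))
        = (if TotDist z z' = true then (1:ℤ) else 0) *
            ((1 - ind V z) * (2 * (ind B (glue (fun _ => 2) z) * ind C (glue (fun _ => 2) z)) - ind B (glue (fun _ => 0) z) * ind C (glue (fun _ => 0) z)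
                - ind B (glue (fun _ => 1) z) * ind C (glue (fun _ => 1) z))
              + (ind B (glue (fun _ => 0) z) * ind C (glue (fun _ => 0) z) + ind B (glue (fun _ => 1) z) * ind C (glue (fun _ => 1) z)) * ind V z)
          - (ind B (glue (fun _ => 0) z) * ind C (glue (fun _ => 0) z) + ind B (glue (fun _ => 1) z) * ind C (glue (fun _ => 1) z))
            * ((if TotDist z z' = true then (1:ℤ) else 0) * ind V z') := by
      intro z'; ring
    rw [e3, Finset.sum_congr rfl (fun z' _ => split z'), Finset.sum_sub_distrib, ← Finset.sum_mul, ← Finset.mul_sum,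
      sum_ite_totDist_eq_two_pow]
    ring
  rw [eC]
  -- the total kernel and the families kernel
  set pL : Pd k → Pd k → Pd k → ℤ := fun z z' z'' =>
      ((2 * (0 + ind V z - 0 * ind V z) * ind B (glue (fun _ => 0) z) * ind C (glue (fun _ => 0) z) - (0 + ind V z - 0 * ind V z) * ind B (glue (fun _ => 1) z') * ind C (glue (fun _ => 1) z') - ind B (glue (fun _ => 0) z) * (0 + ind V z' - 0 * ind V z') * ind C (glue (fun _ => 1) z') - ind C (glue (fun _ => 0) z) * (0 + ind V z' - 0 * ind V z') * ind B (glue (fun _ => 1) z') + ind B (glue (fun _ => 0) z) * ind C (glue (fun _ => 1) z') * (1 + ind V z'' - 1 * ind V z'') - ind B (glue (fun _ => 0) z) * ind C (glue (fun _ => 0) z) * ((1 - ind V z) * (0 - 0) + (1 - 0) * (1 - 0) * (ind V z - ind V z')))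
      + (2 * (0 + ind V z - 0 * ind V z) * ind B (glue (fun _ => 0) z) * ind C (glue (fun _ => 0) z) - (0 + ind V z - 0 * ind V z) * ind B (glue (fun _ => 2) z') * ind C (glue (fun _ => 2) z') - ind B (glue (fun _ => 0) z) * (1 + ind V z' - 1 * ind V z') * ind C (glue (fun _ => 2) z') - ind C (glue (fun _ => 0) z) * (1 + ind V z' - 1 * ind V z') * ind B (glue (fun _ => 2) z') + ind B (glue (fun _ => 0) z) * ind C (glue (fun _ => 2) z') * (0 + ind V z'' - 0 * ind V z'') - ind B (glue (fun _ => 0) z) * ind C (glue (fun _ => 0) z) * ((1 - ind V z) * (0 - 1) + (1 - 0) * (1 - 1) * (ind V z - ind V z')))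
      + (2 * (0 + ind V z - 0 * ind V z) * ind B (glue (fun _ => 1) z) * ind C (glue (fun _ => 1) z) - (0 + ind V z - 0 * ind V z) * ind B (glue (fun _ => 0) z') * ind C (glue (fun _ => 0) z') - ind B (glue (fun _ => 1) z) * (0 + ind V z' - 0 * ind V z') * ind C (glue (fun _ => 0) z') - ind C (glue (fun _ => 1) z) * (0 + ind V z' - 0 * ind V z') * ind B (glue (fun _ => 0) z') + ind B (glue (fun _ => 1) z) * ind C (glue (fun _ => 0) z') * (1 + ind V z'' - 1 * ind V z'') - ind B (glue (fun _ => 1) z) * ind C (glue (fun _ => 1) z) * ((1 - ind V z) * (0 - 0) + (1 - 0) * (1 - 0) * (ind V z - ind V z')))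
      + (2 * (0 + ind V z - 0 * ind V z) * ind B (glue (fun _ => 1) z) * ind C (glue (fun _ => 1) z) - (0 + ind V z - 0 * ind V z) * ind B (glue (fun _ => 2) z') * ind C (glue (fun _ => 2) z') - ind B (glue (fun _ => 1) z) * (1 + ind V z' - 1 * ind V z') * ind C (glue (fun _ => 2) z') - ind C (glue (fun _ => 1) z) * (1 + ind V z' - 1 * ind V z') * ind B (glue (fun _ => 2) z') + ind B (glue (fun _ => 1) z) * ind C (glue (fun _ => 2) z') * (0 + ind V z'' - 0 * ind V z'') - ind B (glue (fun _ => 1) z) * ind C (glue (fun _ => 1) z) * ((1 - ind V z) * (0 - 1) + (1 - 0) * (1 - 1) * (ind V z - ind V z')))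
      + (2 * (1 + ind V z - 1 * ind V z) * ind B (glue (fun _ => 2) z) * ind C (glue (fun _ => 2) z) - (1 + ind V z - 1 * ind V z) * ind B (glue (fun _ => 0) z') * ind C (glue (fun _ => 0) z') - ind B (glue (fun _ => 2) z) * (0 + ind V z' - 0 * ind V z') * ind C (glue (fun _ => 0) z') - ind C (glue (fun _ => 2) z) * (0 + ind V z' - 0 * ind V z') * ind B (glue (fun _ => 0) z') + ind B (glue (fun _ => 2) z) * ind C (glue (fun _ => 0) z') * (0 + ind V z'' - 0 * ind V z'') - ind B (glue (fun _ => 2) z) * ind C (glue (fun _ => 2) z) * ((1 - ind V z) * (1 - 0) + (1 - 1) * (1 - 0) * (ind V z - ind V z')))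
      + (2 * (1 + ind V z - 1 * ind V z) * ind B (glue (fun _ => 2) z) * ind C (glue (fun _ => 2) z) - (1 + ind V z - 1 * ind V z) * ind B (glue (fun _ => 1) z') * ind C (glue (fun _ => 1) z') - ind B (glue (fun _ => 2) z) * (0 + ind V z' - 0 * ind V z') * ind C (glue (fun _ => 1) z') - ind C (glue (fun _ => 2) z) * (0 + ind V z' - 0 * ind V z') * ind B (glue (fun _ => 1) z') + ind B (glue (fun _ => 2) z) * ind C (glue (fun _ => 1) z') * (0 + ind V z'' - 0 * ind V z'') - ind B (glue (fun _ => 2) z) * ind C (glue (fun _ => 2) z) * ((1 - ind V z) * (1 - 0) + (1 - 1) * (1 - 0) * (ind V z - ind V z'))))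
      + ((1 - ind V z) * (2 * (ind B (glue (fun _ => 2) z) * ind C (glue (fun _ => 2) z)) - ind B (glue (fun _ => 0) z) * ind C (glue (fun _ => 0) z) - ind B (glue (fun _ => 1) z) * ind C (glue (fun _ => 1) z)) + (ind B (glue (fun _ => 0) z) * ind C (glue (fun _ => 0) z) + ind B (glue (fun _ => 1) z) * ind C (glue (fun _ => 1) z)) * (ind V z - ind V z'))
      - ((ind B (glue (fun _ => 0) z) * ind C (glue (fun _ => 1) z) * (2 * ind V z - ind V z') - ind B (glue (fun _ => 0) z) * ind C (glue (fun _ => 1) z') * (ind V z + ind V z' - ind V z'')) + (ind B (glue (fun _ => 1) z) * ind C (glue (fun _ => 0) z) * (2 * ind V z - ind V z') - ind B (glue (fun _ => 1) z) * ind C (glue (fun _ => 0) z') * (ind V z + ind V z' - ind V z''))) with hpL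
  set pR : Pd k → Pd k → Pd k → ℤ := fun z z' z'' =>
      ind B (glue (fun _ => 2) z) * (ind C (glue (fun _ => 0) z) * ind V z - ind C (glue (fun _ => 0) z') * ind V z')
      + ind B (glue (fun _ => 2) z) * (ind C (glue (fun _ => 1) z) * ind V z - ind C (glue (fun _ => 1) z') * ind V z')
      + ind C (glue (fun _ => 2) z) * (ind B (glue (fun _ => 0) z) * ind V z - ind B (glue (fun _ => 0) z') * ind V z')
      + ind C (glue (fun _ => 2) z) * (ind B (glue (fun _ => 1) z) * ind V z - ind B (glue (fun _ => 1) z') * ind V z')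
      + 2 * ((1 - ind V z) * ind B (glue (fun _ => 2) z') * (ind C (glue (fun _ => 2) z') - ind C (glue (fun _ => 2) z'')))
      + ((ind B (glue (fun _ => 2) z) - ind B (glue (fun _ => 1) z)) * (ind C (glue (fun _ => 2) z) - ind C (glue (fun _ => 0) z)))
      + ((ind B (glue (fun _ => 2) z) - ind B (glue (fun _ => 0) z)) * (ind C (glue (fun _ => 2) z) - ind C (glue (fun _ => 1) z)))
      + 2 * (ind V z * ((ind B (glue (fun _ => 1) z) - ind B (glue (fun _ => 0) z)) * (ind C (glue (fun _ => 1) z) - ind C (glue (fun _ => 0) z))))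
      + ((1 - ind V z) * (ind B (glue (fun _ => 0) z) * (ind C (glue (fun _ => 2) z) - ind C (glue (fun _ => 0) z))))
      + ((1 - ind V z) * (ind B (glue (fun _ => 1) z) * (ind C (glue (fun _ => 2) z) - ind C (glue (fun _ => 1) z))))
      + ((1 - ind V z) * ((ind B (glue (fun _ => 1) z') - ind B (glue (fun _ => 0) z')) * (ind C (glue (fun _ => 1) z') - ind C (glue (fun _ => 0) z'))))
      + ((1 - ind V z) * ((ind B (glue (fun _ => 2) z) - ind B (glue (fun _ => 1) z)) * ind C (glue (fun _ => 1) z)))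
      + ((1 - ind V z) * ((ind B (glue (fun _ => 2) z') - ind B (glue (fun _ => 1) z')) * (ind C (glue (fun _ => 2) z'') - ind C (glue (fun _ => 0) z''))))
      + ((1 - ind V z) * ((ind B (glue (fun _ => 2) z) - ind B (glue (fun _ => 0) z)) * ind C (glue (fun _ => 0) z)))
      + ((1 - ind V z) * ((ind B (glue (fun _ => 2) z') - ind B (glue (fun _ => 0) z')) * (ind C (glue (fun _ => 2) z'') - ind C (glue (fun _ => 1) z'')))) with hpR
  -- nonnegativity of the families
  have dB : ∀ (s : Pd k) (i j : Fin 3), i ≤ j → 0 ≤ ind B (glue (fun _ => j) s) - ind B (glue (fun _ => i) s) := by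
    intro s i j hij
    have hle : glue (fun _ => i : Pd 1) s ≤ glue (fun _ => j) s := glue_le_glue_iff.2 ⟨fun _ => hij, le_rfl⟩
    linarith [ind_le_ind_of_imp (S := B) (T := B) (fun h => hB hle h)]
  have dC : ∀ (s : Pd k) (i j : Fin 3), i ≤ j → 0 ≤ ind C (glue (fun _ => j) s) - ind C (glue (fun _ => i) s) := by
    intro s i j hij
    have hle : glue (fun _ => i : Pd 1) s ≤ glue (fun _ => j) s := glue_le_glue_iff.2 ⟨fun _ => hij, le_rfl⟩
    linarith [ind_le_ind_of_imp (S := C) (T := C) (fun h => hC hle h)]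
  have hsB : ∀ ξ : Pd 1, IsUpperSet ((sect B ξ : Finset (Pd k)) : Set (Pd k)) := fun ξ => isUpperSet_sect hB ξ
  have hsC : ∀ ξ : Pd 1, IsUpperSet ((sect C ξ : Finset (Pd k)) : Set (Pd k)) := fun ξ => isUpperSet_sect hC ξ
  have F1 : 0 ≤ ∑ z : Pd k, ∑ z' : Pd k, (if TotDist z z' = true then (1:ℤ) else 0) * (ind B (glue (fun _ => 2) z) * (ind C (glue (fun _ => 0) z) * ind V z - ind C (glue (fun _ => 0) z') * ind V z')) := by
    have h := pairKernel_harris_nonneg (sect B (fun _ => 2)) (sect C (fun _ => 0) ∩ V) (hsB _) (isUpperSet_inter_coe (hsC _) hV)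
    simp only [ind_inter_eq_mul, ind_sect] at h
    refine le_of_le_of_eq h ?_
    exact Finset.sum_congr rfl fun z _ => Finset.sum_congr rfl fun z' _ => by ring
  have F2 : 0 ≤ ∑ z : Pd k, ∑ z' : Pd k, (if TotDist z z' = true then (1:ℤ) else 0) * (ind B (glue (fun _ => 2) z) * (ind C (glue (fun _ => 1) z) * ind V z - ind C (glue (fun _ => 1) z') * ind V z')) := by
    have h := pairKernel_harris_nonneg (sect B (fun _ => 2)) (sect C (fun _ => 1) ∩ V) (hsB _) (isUpperSet_inter_coe (hsC _) hV)
    simp only [ind_inter_eq_mul, ind_sect] at h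
    refine le_of_le_of_eq h ?_
    exact Finset.sum_congr rfl fun z _ => Finset.sum_congr rfl fun z' _ => by ring
  have F3 : 0 ≤ ∑ z : Pd k, ∑ z' : Pd k, (if TotDist z z' = true then (1:ℤ) else 0) * (ind C (glue (fun _ => 2) z) * (ind B (glue (fun _ => 0) z) * ind V z - ind B (glue (fun _ => 0) z') * ind V z')) := by
    have h := pairKernel_harris_nonneg (sect C (fun _ => 2)) (sect B (fun _ => 0) ∩ V) (hsC _) (isUpperSet_inter_coe (hsB _) hV)
    simp only [ind_inter_eq_mul, ind_sect] at h
    refine le_of_le_of_eq h ?_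
    exact Finset.sum_congr rfl fun z _ => Finset.sum_congr rfl fun z' _ => by ring
  have F4 : 0 ≤ ∑ z : Pd k, ∑ z' : Pd k, (if TotDist z z' = true then (1:ℤ) else 0) * (ind C (glue (fun _ => 2) z) * (ind B (glue (fun _ => 1) z) * ind V z - ind B (glue (fun _ => 1) z') * ind V z')) := by
    have h := pairKernel_harris_nonneg (sect C (fun _ => 2)) (sect B (fun _ => 1) ∩ V) (hsC _) (isUpperSet_inter_coe (hsB _) hV)
    simp only [ind_inter_eq_mul, ind_sect] at h
    refine le_of_le_of_eq h ?_
    exact Finset.sum_congr rfl fun z _ => Finset.sum_congr rfl fun z' _ => by ring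
  have F5 : 0 ≤ ∑ z : Pd k, ∑ z' : Pd k, (if TotDist z z' = true then (1:ℤ) else 0) * ((1 - ind V z) * ind B (glue (fun _ => 2) z') * (ind C (glue (fun _ => 2) z') - ind C (glue (fun _ => 2) (thirdPt z z')))) := by
    have h := pairKernel_kleitman_nonneg (univ \ V) (sect B (fun _ => 2)) (sect C (fun _ => 2)) (hsB _) (hsC _)
    simp only [ind_sdiff_univ, ind_sect] at h
    refine le_of_le_of_eq h ?_
    exact Finset.sum_congr rfl fun z _ => Finset.sum_congr rfl fun z' _ => by ring
  have hv0 : ∀ z : Pd k, 0 ≤ ind V z := fun z => ind_nonneg' V z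
  have hv1 : ∀ z : Pd k, 0 ≤ 1 - ind V z := fun z => by linarith [ind_le_one' V z]
  have hb0 : ∀ (i : Fin 3) (z : Pd k), 0 ≤ ind B (glue (fun _ => i) z) := fun i z => ind_nonneg' B _
  have hc0 : ∀ (i : Fin 3) (z : Pd k), 0 ≤ ind C (glue (fun _ => i) z) := fun i z => ind_nonneg' C _
  have PW : 0 ≤ ∑ z : Pd k, ∑ z' : Pd k, (if TotDist z z' = true then (1:ℤ) else 0) * (
      ((ind B (glue (fun _ => 2) z) - ind B (glue (fun _ => 1) z)) * (ind C (glue (fun _ => 2) z) - ind C (glue (fun _ => 0) z)))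
      + ((ind B (glue (fun _ => 2) z) - ind B (glue (fun _ => 0) z)) * (ind C (glue (fun _ => 2) z) - ind C (glue (fun _ => 1) z)))
      + 2 * (ind V z * ((ind B (glue (fun _ => 1) z) - ind B (glue (fun _ => 0) z)) * (ind C (glue (fun _ => 1) z) - ind C (glue (fun _ => 0) z))))
      + ((1 - ind V z) * (ind B (glue (fun _ => 0) z) * (ind C (glue (fun _ => 2) z) - ind C (glue (fun _ => 0) z))))
      + ((1 - ind V z) * (ind B (glue (fun _ => 1) z) * (ind C (glue (fun _ => 2) z) - ind C (glue (fun _ => 1) z))))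
      + ((1 - ind V z) * ((ind B (glue (fun _ => 1) z') - ind B (glue (fun _ => 0) z')) * (ind C (glue (fun _ => 1) z') - ind C (glue (fun _ => 0) z'))))
      + ((1 - ind V z) * ((ind B (glue (fun _ => 2) z) - ind B (glue (fun _ => 1) z)) * ind C (glue (fun _ => 1) z)))
      + ((1 - ind V z) * ((ind B (glue (fun _ => 2) z') - ind B (glue (fun _ => 1) z')) * (ind C (glue (fun _ => 2) (thirdPt z z')) - ind C (glue (fun _ => 0) (thirdPt z z')))))
      + ((1 - ind V z) * ((ind B (glue (fun _ => 2) z) - ind B (glue (fun _ => 0) z)) * ind C (glue (fun _ => 0) z)))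
      + ((1 - ind V z) * ((ind B (glue (fun _ => 2) z') - ind B (glue (fun _ => 0) z')) * (ind C (glue (fun _ => 2) (thirdPt z z')) - ind C (glue (fun _ => 1) (thirdPt z z'))))) ) := by
    refine Finset.sum_nonneg fun z _ => Finset.sum_nonneg fun z' _ => mul_nonneg (by split_ifs <;> norm_num) ?_
    have d21B := dB z 1 2 (by decide); have d20B := dB z 0 2 (by decide); have d10B := dB z 0 1 (by decide)
    have d21C := dC z 1 2 (by decide); have d20C := dC z 0 2 (by decide); have d10C := dC z 0 1 (by decide)
    have d10B' := dB z' 0 1 (by decide); have d10C' := dC z' 0 1 (by decide)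
    have d21B' := dB z' 1 2 (by decide); have d20B' := dB z' 0 2 (by decide)
    have d20C'' := dC (thirdPt z z') 0 2 (by decide); have d21C'' := dC (thirdPt z z') 1 2 (by decide)
    have v0 := hv0 z; have v1 := hv1 z
    have a0 := hb0 0 z; have a1 := hb0 1 z; have b0 := hc0 0 z; have b1 := hc0 1 z
    linarith [mul_nonneg d21B d20C, mul_nonneg d20B d21C, mul_nonneg v0 (mul_nonneg d10B d10C), mul_nonneg v1 (mul_nonneg a0 d20C), mul_nonneg v1 (mul_nonneg a1 d21C), mul_nonneg v1 (mul_nonneg d10B' d10C'), mul_nonneg v1 (mul_nonneg d21B b1), mul_nonneg v1 (mul_nonneg d21B' d20C''), mul_nonneg v1 (mul_nonneg d20B b0), mul_nonneg v1 (mul_nonneg d20B' d21C'')]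
  -- the symmetrised kernel identity
  have hsym : ∀ z z' z'' : Pd k, pL z z' z'' + pL z z'' z' + pL z' z z'' + pL z' z'' z + pL z'' z z' + pL z'' z' z
      = pR z z' z'' + pR z z'' z' + pR z' z z'' + pR z' z'' z + pR z'' z z' + pR z'' z' z := by
    intro z z' z''
    simp only [hpL, hpR]
    ring
  have k3 : (∑ z : Pd k, ∑ z' : Pd k, (if TotDist z z' = true then (1:ℤ) else 0) * pL z z' (thirdPt z z'))
      = ∑ z : Pd k, ∑ z' : Pd k, (if TotDist z z' = true then (1:ℤ) else 0) * pR z z' (thirdPt z z') := by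
    have h6 : 6 * (∑ z : Pd k, ∑ z' : Pd k, (if TotDist z z' = true then (1:ℤ) else 0) * pL z z' (thirdPt z z'))
        = 6 * (∑ z : Pd k, ∑ z' : Pd k, (if TotDist z z' = true then (1:ℤ) else 0) * pR z z' (thirdPt z z')) := by
      rw [pairSum_sym6 pL, pairSum_sym6 pR]
      exact Finset.sum_congr rfl fun z _ => Finset.sum_congr rfl fun z' _ => by rw [hsym]
    exact mul_left_cancel₀ (by norm_num : (6:ℤ) ≠ 0) h6
  -- right kernel = the families
  have k2 : (∑ z : Pd k, ∑ z' : Pd k, (if TotDist z z' = true then (1:ℤ) else 0) * pR z z' (thirdPt z z'))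
      = (∑ z : Pd k, ∑ z' : Pd k, (if TotDist z z' = true then (1:ℤ) else 0) * (ind B (glue (fun _ => 2) z) * (ind C (glue (fun _ => 0) z) * ind V z - ind C (glue (fun _ => 0) z') * ind V z')))
        + (∑ z : Pd k, ∑ z' : Pd k, (if TotDist z z' = true then (1:ℤ) else 0) * (ind B (glue (fun _ => 2) z) * (ind C (glue (fun _ => 1) z) * ind V z - ind C (glue (fun _ => 1) z') * ind V z')))
        + (∑ z : Pd k, ∑ z' : Pd k, (if TotDist z z' = true then (1:ℤ) else 0) * (ind C (glue (fun _ => 2) z) * (ind B (glue (fun _ => 0) z) * ind V z - ind B (glue (fun _ => 0) z') * ind V z')))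
        + (∑ z : Pd k, ∑ z' : Pd k, (if TotDist z z' = true then (1:ℤ) else 0) * (ind C (glue (fun _ => 2) z) * (ind B (glue (fun _ => 1) z) * ind V z - ind B (glue (fun _ => 1) z') * ind V z')))
        + 2 * (∑ z : Pd k, ∑ z' : Pd k, (if TotDist z z' = true then (1:ℤ) else 0) * ((1 - ind V z) * ind B (glue (fun _ => 2) z') * (ind C (glue (fun _ => 2) z') - ind C (glue (fun _ => 2) (thirdPt z z')))))
        + (∑ z : Pd k, ∑ z' : Pd k, (if TotDist z z' = true then (1:ℤ) else 0) * (
            ((ind B (glue (fun _ => 2) z) - ind B (glue (fun _ => 1) z)) * (ind C (glue (fun _ => 2) z) - ind C (glue (fun _ => 0) z)))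
      + ((ind B (glue (fun _ => 2) z) - ind B (glue (fun _ => 0) z)) * (ind C (glue (fun _ => 2) z) - ind C (glue (fun _ => 1) z)))
      + 2 * (ind V z * ((ind B (glue (fun _ => 1) z) - ind B (glue (fun _ => 0) z)) * (ind C (glue (fun _ => 1) z) - ind C (glue (fun _ => 0) z))))
      + ((1 - ind V z) * (ind B (glue (fun _ => 0) z) * (ind C (glue (fun _ => 2) z) - ind C (glue (fun _ => 0) z))))
      + ((1 - ind V z) * (ind B (glue (fun _ => 1) z) * (ind C (glue (fun _ => 2) z) - ind C (glue (fun _ => 1) z))))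
      + ((1 - ind V z) * ((ind B (glue (fun _ => 1) z') - ind B (glue (fun _ => 0) z')) * (ind C (glue (fun _ => 1) z') - ind C (glue (fun _ => 0) z'))))
      + ((1 - ind V z) * ((ind B (glue (fun _ => 2) z) - ind B (glue (fun _ => 1) z)) * ind C (glue (fun _ => 1) z)))
      + ((1 - ind V z) * ((ind B (glue (fun _ => 2) z') - ind B (glue (fun _ => 1) z')) * (ind C (glue (fun _ => 2) (thirdPt z z')) - ind C (glue (fun _ => 0) (thirdPt z z')))))
      + ((1 - ind V z) * ((ind B (glue (fun _ => 2) z) - ind B (glue (fun _ => 0) z)) * ind C (glue (fun _ => 0) z)))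
      + ((1 - ind V z) * ((ind B (glue (fun _ => 2) z') - ind B (glue (fun _ => 0) z')) * (ind C (glue (fun _ => 2) (thirdPt z z')) - ind C (glue (fun _ => 1) (thirdPt z z'))))) )) := by
    simp only [Finset.mul_sum, ← Finset.sum_add_distrib]
    refine Finset.sum_congr rfl fun z _ => Finset.sum_congr rfl fun z' _ => ?_
    simp only [hpR]
    ring
  have main : 0 ≤ ∑ z : Pd k, ∑ z' : Pd k, (if TotDist z z' = true then (1:ℤ) else 0) * pL z z' (thirdPt z z') := by
    rw [k3, k2]
    have h5 : (0:ℤ) ≤ 2 * (∑ z : Pd k, ∑ z' : Pd k, (if TotDist z z' = true then (1:ℤ) else 0) * ((1 - ind V z) * ind B (glue (fun _ => 2) z') * (ind C (glue (fun _ => 2) z') - ind C (glue (fun _ => 2) (thirdPt z z'))))) :=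
      mul_nonneg (by norm_num) F5
    linarith [F1, F2, F3, F4, PW]
  -- assemble: the goal's difference is the pair sum of pL
  rw [← sub_nonneg]
  refine le_of_le_of_eq main ?_
  simp only [← Finset.sum_add_distrib, ← Finset.sum_sub_distrib]
  refine Finset.sum_congr rfl fun z _ => Finset.sum_congr rfl fun z' _ => ?_
  simp only [hpL]
  ring

/-- **GOODNESS IS PRESERVED BY THE THRESHOLD-TWO LITERAL** (no certificate): if `sStarD V P R ≥ 0` for all up-sets `P, R ⊆ [3]^k`
(the up-set `V` is a good first slot of the pattern functional in its own dimension), then `0 ≤ sStarD ({ξ=2} ∪ cyl V) B C` for all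
up-sets `B, C ⊆ [3]^{1+k}`. [this work] -/
theorem sStarD_literalTwo_nonneg_of_good (ℓ : Pd 1) (hℓ : ℓ 0 = 2) {V : Finset (Pd k)} (hV : IsUpperSet (V : Set (Pd k)))
    (hgood : ∀ P R : Finset (Pd k), IsUpperSet (P : Set (Pd k)) → IsUpperSet (R : Set (Pd k)) → 0 ≤ sStarD V P R)
    {X Y : Finset (Pd (1 + k))}
    (hX : ∀ ξ z, glue ξ z ∈ X ↔ ξ ∈ (univ.filter fun y : Pd 1 => ∀ j, ℓ j ≤ y j)) (hY : ∀ ξ z, glue ξ z ∈ Y ↔ z ∈ V)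
    (B C : Finset (Pd (1 + k))) (hB : IsUpperSet (B : Set (Pd (1 + k)))) (hC : IsUpperSet (C : Set (Pd (1 + k)))) :
    0 ≤ sStarD (X ∪ Y) B C := by
  have h := sStarD_literalTwo_ge_sections ℓ hℓ hV hX hY B C hB hC
  have h1 := hgood (sect B (fun _ => 0)) (sect C (fun _ => 1)) (isUpperSet_sect hB _) (isUpperSet_sect hC _)
  have h2 := hgood (sect B (fun _ => 1)) (sect C (fun _ => 0)) (isUpperSet_sect hB _) (isUpperSet_sect hC _)
  linarith

/-! ### Appendix (generation 25, second proposal): the all-dimension form and two kernel tools for any first slot -/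

/-- **All dimensions, no re-indexing needed**: if `V ⊆ [3]^k` is a good first slot IN EVERY DIMENSION (`cylSet V ⊆ [3]^{m+k}` good for all `m`),
then for every `m` the slot `{ξ=2} × [3]^{m+k} ∪ [3] × cylSet V ⊆ [3]^{1+(m+k)}` (the threshold-two literal over `V` with `m` free axes inserted
after the literal axis) is good: apply `sStarD_literalTwo_nonneg_of_good` to the good up-set `cylSet V`.  Any other placement of the free axes
follows by `sStarD_nonneg_transfer`. [this work] -/
theorem sStarD_literalTwo_cylSet_nonneg_of_good (ℓ : Pd 1) (hℓ : ℓ 0 = 2) {V : Finset (Pd k)} (hV : IsUpperSet (V : Set (Pd k)))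
    (hgood : ∀ (m : ℕ) (P R : Finset (Pd (m + k))), IsUpperSet (P : Set (Pd (m + k))) → IsUpperSet (R : Set (Pd (m + k))) →
      0 ≤ sStarD (cylSet V : Finset (Pd (m + k))) P R)
    (m : ℕ) {X Y : Finset (Pd (1 + (m + k)))}
    (hX : ∀ ξ z, glue ξ z ∈ X ↔ ξ ∈ (univ.filter fun y : Pd 1 => ∀ j, ℓ j ≤ y j))
    (hY : ∀ ξ z, glue ξ z ∈ Y ↔ z ∈ (cylSet V : Finset (Pd (m + k))))
    (B C : Finset (Pd (1 + (m + k)))) (hB : IsUpperSet (B : Set (Pd (1 + (m + k))))) (hC : IsUpperSet (C : Set (Pd (1 + (m + k))))) :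
    0 ≤ sStarD (X ∪ Y) B C :=
  sStarD_literalTwo_nonneg_of_good ℓ hℓ (isUpperSet_cylSet hV) (hgood m) hX hY B C hB hC

section GluePairSum
variable {n : ℕ}

/-- **The pattern functional of ANY first slot as a two-block pair sum**: for every `A, B, C ⊆ [3]^{n+k}`,
`sStarD A B C = Σ_{ξ δ̸ η} Σ_{q δ̸ r} h`, `h` the three-copy kernel read at the glued points `(ξ,q), (η,r)` and their third point. [this work] -/
theorem sStarD_eq_glue_pairSum (A B C : Finset (Pd (n + k))) :
    sStarD A B C = ∑ ξ : Pd n, ∑ η : Pd n, ∑ q : Pd k, ∑ r : Pd k,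
      (if TotDist ξ η = true then (1:ℤ) else 0) * (if TotDist q r = true then (1:ℤ) else 0) *
        ( 2 * ind A (glue ξ q) * ind B (glue ξ q) * ind C (glue ξ q)
          - ind A (glue ξ q) * ind B (glue η r) * ind C (glue η r)
          - ind B (glue ξ q) * ind A (glue η r) * ind C (glue η r)
          - ind C (glue ξ q) * ind A (glue η r) * ind B (glue η r)
          + ind B (glue ξ q) * ind C (glue η r) * ind A (glue (thirdPt ξ η) (thirdPt q r)) ) := by
  rw [sStarD_counting]
  have e1 : 2 * 2 ^ (n + k) * (∑ p : Pd (n + k), ind A p * ind B p * ind C p) =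
      ∑ ξ : Pd n, ∑ η : Pd n, ∑ q : Pd k, ∑ r : Pd k, (if TotDist ξ η = true then (1:ℤ) else 0) * (if TotDist q r = true then (1:ℤ) else 0) *
        (2 * ind A (glue ξ q) * ind B (glue ξ q) * ind C (glue ξ q)) := by
    have hc : 2 * (2:ℤ) ^ (n + k) * (∑ p : Pd (n + k), ind A p * ind B p * ind C p)
        = 2 ^ n * 2 ^ k * (∑ p : Pd (n + k), 2 * (ind A p * ind B p * ind C p)) := by
      rw [pow_add, Finset.mul_sum, Finset.mul_sum]
      refine Finset.sum_congr rfl fun p _ => ?_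
      ring
    rw [hc, sum_eq_pairSum_const]
    refine Finset.sum_congr rfl fun ξ _ => Finset.sum_congr rfl fun η _ => Finset.sum_congr rfl fun q _ => Finset.sum_congr rfl fun r _ => ?_
    ring
  have e2 : (∑ p : Pd (n + k), ∑ q' : Pd (n + k), ind A p * ind B q' * ind C q' * (if TotDist p q' = true then (1:ℤ) else 0)) =
      ∑ ξ : Pd n, ∑ η : Pd n, ∑ q : Pd k, ∑ r : Pd k, (if TotDist ξ η = true then (1:ℤ) else 0) * (if TotDist q r = true then (1:ℤ) else 0) *
        (ind A (glue ξ q) * ind B (glue η r) * ind C (glue η r)) := by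
    rw [pairSum_glue (fun p q' => ind A p * ind B q' * ind C q')]
  have e3 : (∑ p : Pd (n + k), ∑ q' : Pd (n + k), ind B p * ind A q' * ind C q' * (if TotDist p q' = true then (1:ℤ) else 0)) =
      ∑ ξ : Pd n, ∑ η : Pd n, ∑ q : Pd k, ∑ r : Pd k, (if TotDist ξ η = true then (1:ℤ) else 0) * (if TotDist q r = true then (1:ℤ) else 0) *
        (ind B (glue ξ q) * ind A (glue η r) * ind C (glue η r)) := by
    rw [pairSum_glue (fun p q' => ind B p * ind A q' * ind C q')]
  have e4 : (∑ p : Pd (n + k), ∑ q' : Pd (n + k), ind C p * ind A q' * ind B q' * (if TotDist p q' = true then (1:ℤ) else 0)) =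
      ∑ ξ : Pd n, ∑ η : Pd n, ∑ q : Pd k, ∑ r : Pd k, (if TotDist ξ η = true then (1:ℤ) else 0) * (if TotDist q r = true then (1:ℤ) else 0) *
        (ind C (glue ξ q) * ind A (glue η r) * ind B (glue η r)) := by
    rw [pairSum_glue (fun p q' => ind C p * ind A q' * ind B q')]
  have e5 : (∑ q' : Pd (n + k), ∑ r' : Pd (n + k), ind B q' * ind C r' * ind A (thirdPt q' r') * (if TotDist q' r' = true then (1:ℤ) else 0)) =
      ∑ ξ : Pd n, ∑ η : Pd n, ∑ q : Pd k, ∑ r : Pd k, (if TotDist ξ η = true then (1:ℤ) else 0) * (if TotDist q r = true then (1:ℤ) else 0) *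
        (ind B (glue ξ q) * ind C (glue η r) * ind A (glue (thirdPt ξ η) (thirdPt q r))) := by
    rw [pairSum_glue (fun q' r' => ind B q' * ind C r' * ind A (thirdPt q' r'))]
    refine Finset.sum_congr rfl fun ξ _ => Finset.sum_congr rfl fun η _ => Finset.sum_congr rfl fun q _ => Finset.sum_congr rfl fun r _ => ?_
    rw [thirdPt_glue]
  rw [e1, e2, e3, e4, e5]
  simp only [← Finset.sum_sub_distrib, ← Finset.sum_add_distrib]
  refine Finset.sum_congr rfl fun ξ _ => Finset.sum_congr rfl fun η _ => Finset.sum_congr rfl fun q _ => Finset.sum_congr rfl fun r _ => ?_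
  ring

/-- **One literal axis explicit, any first slot**: for `A, B, C ⊆ [3]^{1+k}`, `sStarD A B C` is the pair sum over totally distinct `(q, r)` of
`[3]^k` of the three-copy kernel read at the six orderings `(i, j, l)` of the literal axis (sections `S_i = sect S i`). [this work] -/
theorem sStarD_eq_pd1_sections (A B C : Finset (Pd (1 + k))) :
    sStarD A B C = ∑ q : Pd k, ∑ r : Pd k, (if TotDist q r = true then (1:ℤ) else 0) *
      ( (2 * ind A (glue (fun _ => 0) q) * ind B (glue (fun _ => 0) q) * ind C (glue (fun _ => 0) q) - ind A (glue (fun _ => 0) q) * ind B (glue (fun _ => 1) r) * ind C (glue (fun _ => 1) r) - ind B (glue (fun _ => 0) q) * ind A (glue (fun _ => 1) r) * ind C (glue (fun _ => 1) r) - ind C (glue (fun _ => 0) q) * ind A (glue (fun _ => 1) r) * ind B (glue (fun _ => 1) r) + ind B (glue (fun _ => 0) q) * ind C (glue (fun _ => 1) r) * ind A (glue (fun _ => 2) (thirdPt q r)))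
        + (2 * ind A (glue (fun _ => 0) q) * ind B (glue (fun _ => 0) q) * ind C (glue (fun _ => 0) q) - ind A (glue (fun _ => 0) q) * ind B (glue (fun _ => 2) r) * ind C (glue (fun _ => 2) r) - ind B (glue (fun _ => 0) q) * ind A (glue (fun _ => 2) r) * ind C (glue (fun _ => 2) r) - ind C (glue (fun _ => 0) q) * ind A (glue (fun _ => 2) r) * ind B (glue (fun _ => 2) r) + ind B (glue (fun _ => 0) q) * ind C (glue (fun _ => 2) r) * ind A (glue (fun _ => 1) (thirdPt q r)))
        + (2 * ind A (glue (fun _ => 1) q) * ind B (glue (fun _ => 1) q) * ind C (glue (fun _ => 1) q) - ind A (glue (fun _ => 1) q) * ind B (glue (fun _ => 0) r) * ind C (glue (fun _ => 0) r) - ind B (glue (fun _ => 1) q) * ind A (glue (fun _ => 0) r) * ind C (glue (fun _ => 0) r) - ind C (glue (fun _ => 1) q) * ind A (glue (fun _ => 0) r) * ind B (glue (fun _ => 0) r) + ind B (glue (fun _ => 1) q) * ind C (glue (fun _ => 0) r) * ind A (glue (fun _ => 2) (thirdPt q r)))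
        + (2 * ind A (glue (fun _ => 1) q) * ind B (glue (fun _ => 1) q) * ind C (glue (fun _ => 1) q) - ind A (glue (fun _ => 1) q) * ind B (glue (fun _ => 2) r) * ind C (glue (fun _ => 2) r) - ind B (glue (fun _ => 1) q) * ind A (glue (fun _ => 2) r) * ind C (glue (fun _ => 2) r) - ind C (glue (fun _ => 1) q) * ind A (glue (fun _ => 2) r) * ind B (glue (fun _ => 2) r) + ind B (glue (fun _ => 1) q) * ind C (glue (fun _ => 2) r) * ind A (glue (fun _ => 0) (thirdPt q r)))
        + (2 * ind A (glue (fun _ => 2) q) * ind B (glue (fun _ => 2) q) * ind C (glue (fun _ => 2) q) - ind A (glue (fun _ => 2) q) * ind B (glue (fun _ => 0) r) * ind C (glue (fun _ => 0) r) - ind B (glue (fun _ => 2) q) * ind A (glue (fun _ => 0) r) * ind C (glue (fun _ => 0) r) - ind C (glue (fun _ => 2) q) * ind A (glue (fun _ => 0) r) * ind B (glue (fun _ => 0) r) + ind B (glue (fun _ => 2) q) * ind C (glue (fun _ => 0) r) * ind A (glue (fun _ => 1) (thirdPt q r)))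
        + (2 * ind A (glue (fun _ => 2) q) * ind B (glue (fun _ => 2) q) * ind C (glue (fun _ => 2) q) - ind A (glue (fun _ => 2) q) * ind B (glue (fun _ => 1) r) * ind C (glue (fun _ => 1) r) - ind B (glue (fun _ => 2) q) * ind A (glue (fun _ => 1) r) * ind C (glue (fun _ => 1) r) - ind C (glue (fun _ => 2) q) * ind A (glue (fun _ => 1) r) * ind B (glue (fun _ => 1) r) + ind B (glue (fun _ => 2) q) * ind C (glue (fun _ => 1) r) * ind A (glue (fun _ => 0) (thirdPt q r))) ) := by
  obtain ⟨-, -, -, -, -, -, -, -, -, t01, t02, t10, t12, t20, t21⟩ := pd1_facts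
  rw [sStarD_eq_glue_pairSum]
  rw [pairSum3_pd1_explicit (m := k) (fun (ξ η : Pd 1) (q r : Pd k) =>
        ( 2 * ind A (glue ξ q) * ind B (glue ξ q) * ind C (glue ξ q)
          - ind A (glue ξ q) * ind B (glue η r) * ind C (glue η r)
          - ind B (glue ξ q) * ind A (glue η r) * ind C (glue η r)
          - ind C (glue ξ q) * ind A (glue η r) * ind B (glue η r)
          + ind B (glue ξ q) * ind C (glue η r) * ind A (glue (thirdPt ξ η) (thirdPt q r)) ))]
  simp only [t01, t02, t10, t12, t20, t21]


end GluePairSum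

end Summit.CriticalPhenomena.PercolationContinuityZ3.Theorems.SahiGridPattern
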